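import Mathlib.Analysis.Calculus.Gradient.Basic
import Mathlib.Analysis.InnerProductSpace.Calculus
import Mathlib.Analysis.Calculus.LocalExtr.Basic
import Literature.Analysis.Convex.Subgradient
import Literature.Analysis.FunctionSpaces.FlatTorus
import HarnessLib

/-!
# Serre's gradient bound for periodic perturbations of a convex quadratic (Serre 2024, Lemma 12)

If `θ : ℝⁿ → ℝ` is differentiable and periodic with respect to the unit lattice `ℤⁿ`, and
`x ↦ μ |x|²/2 + θ(x)` is convex for some `μ > 0`, then

`sup_x |∇θ(x)| ≤ μ √n`.

This is Lemma 12 of D. Serre, *Compensated integrability on tori* (there for the lattice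
`2πℤⁿ`, with the bound `2μ√n π = μ √n · 2π`; the statement scales with the period, and the tree's
flat torus `FunctionSpaces.Torus` is `ℝⁿ/ℤⁿ`) — the a-priori bound on the gradient of the periodic
Monge–Ampère potential `θ` in the direct proof of Compensated Integrability on `𝕋ⁿ`
(Serre 2024, Appendix A, (25)). Serre's proof is followed verbatim: monotonicity of the gradient of
the convex function `μ|x|²/2 + θ` between `x + ω` (`ω` a lattice vector, using the periodicity of
`∇θ`) and a maximum point `y` of `θ` (`∇θ(y) = 0`), with `ω` chosen so that
`α = ω + x - y + ∇θ(x)/(2μ)` lies in the cube `[-1/2, 1/2]ⁿ`, gives `μ|α|² ≥ |∇θ(x)|²/(4μ)`.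

* `fderiv_add_latticeVec_of_periodic` — the derivative of a lattice-periodic function is periodic;
* `exists_forall_le_of_periodic` — a continuous lattice-periodic function attains its maximum;
* `inner_fderiv_sub_nonneg_of_convexOn_add_sq` — `μ|x - y|² + (Dθ(x) - Dθ(y))(x - y) ≥ 0`
  (monotonicity of the gradient of the convex `μ|·|²/2 + θ`, from the first-order inequality
  `Literature.Analysis.Convex.ConvexOn.apply_add_fderiv_le`);
* **`norm_gradient_le_of_periodic_of_convexOn`** — Lemma 12: `|∇θ(x)| ≤ μ √n`.

-- TODO(general form): arbitrary lattice `L ℤⁿ` (bound `μ √n L`) by scaling; only the unit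
-- lattice of `FunctionSpaces.Torus` is treated.

## References

* D. Serre, *Compensated integrability on tori; a priori estimate for space-periodic gas flows*,
  C. R. Math. Acad. Sci. Paris 362 (2024) 1425–1444, Appendix A, Lemma 12 (p. 1441). [Serre2024]
-/

open Set Filter InnerProductSpace
open scoped RealInnerProductSpace Topology

namespace Literature.Analysis.Convex

open Literature.Analysis.FunctionSpaces

variable {ι : Type*} [Fintype ι] [DecidableEq ι]

/-- The Fréchet derivative of a lattice-periodic function is lattice-periodic. [folklore] -/
theorem fderiv_add_latticeVec_of_periodic {F : Type*} [NormedAddCommGroup F] [NormedSpace ℝ F]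
    {θ : EuclideanSpace ℝ ι → F}
    (hper : ∀ (x : EuclideanSpace ℝ ι) (k : ι → ℤ), θ (x + Torus.latticeVec k) = θ x)
    (x : EuclideanSpace ℝ ι) (k : ι → ℤ) :
    fderiv ℝ θ (x + Torus.latticeVec k) = fderiv ℝ θ x := by
  have hfun : (fun y => θ (y + Torus.latticeVec k)) = θ := funext fun y => hper y k
  rw [← fderiv_comp_add_right, hfun]

/-- Reduction of a point modulo the lattice into the unit cube: `x - ⌊x⌋ ∈ [0, 1)ⁿ`. [folklore] -/
theorem exists_latticeVec_mem_cube (x : EuclideanSpace ℝ ι) :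
    ∃ k : ι → ℤ, ∀ i, (x + Torus.latticeVec k) i ∈ Icc (0 : ℝ) 1 := by
  refine ⟨fun i => -⌊x i⌋, fun i => ?_⟩
  have h : (x + Torus.latticeVec fun i => -⌊x i⌋) i = Int.fract (x i) := by
    rw [PiLp.add_apply, Torus.latticeVec_apply, Int.cast_neg, Int.fract]
    ring
  rw [h]
  exact ⟨Int.fract_nonneg _, (Int.fract_lt_one _).le⟩

/-- A continuous lattice-periodic function on `ℝⁿ` attains its maximum (on the compact unit cube,
then everywhere by periodicity). [folklore] -/
theorem exists_forall_le_of_periodic {θ : EuclideanSpace ℝ ι → ℝ} (hcont : Continuous θ)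
    (hper : ∀ (x : EuclideanSpace ℝ ι) (k : ι → ℤ), θ (x + Torus.latticeVec k) = θ x) :
    ∃ y, ∀ x, θ x ≤ θ y := by
  set K : Set (EuclideanSpace ℝ ι) := {y | ∀ i, y i ∈ Icc (0 : ℝ) 1} with hK
  have hKc : IsCompact K := by
    have hpi : IsCompact (Set.pi Set.univ fun _ : ι => Icc (0 : ℝ) 1) :=
      isCompact_univ_pi fun _ => isCompact_Icc
    have himage : K = (WithLp.toLp 2) '' (Set.pi Set.univ fun _ : ι => Icc (0 : ℝ) 1) := by
      ext y
      simp only [hK, mem_setOf_eq, mem_image, mem_univ_pi]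
      constructor
      · intro hy
        exact ⟨WithLp.ofLp y, hy, rfl⟩
      · rintro ⟨z, hz, rfl⟩
        exact hz
    rw [himage]
    exact hpi.image (PiLp.continuous_toLp 2 _)
  have hKne : K.Nonempty := ⟨0, fun i => by simp⟩
  obtain ⟨y, -, hy⟩ := hKc.exists_isMaxOn hKne hcont.continuousOn
  refine ⟨y, fun x => ?_⟩
  obtain ⟨k, hk⟩ := exists_latticeVec_mem_cube x
  rw [← hper x k]
  exact hy hk

omit [DecidableEq ι] in
/-- **Monotonicity of the gradient of `μ|x|²/2 + θ(x)`**: if this function is convex and `θ` is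
differentiable, then `0 ≤ μ |x - y|² + (Dθ(x) - Dθ(y))(x - y)` for all `x, y` (add the two
first-order inequalities `f(x) + Df(x)(y - x) ≤ f(y)`). [folklore] -/
theorem inner_fderiv_sub_nonneg_of_convexOn_add_sq {θ : EuclideanSpace ℝ ι → ℝ} {μ : ℝ}
    (hdiff : Differentiable ℝ θ)
    (hconv : ConvexOn ℝ Set.univ fun x => μ / 2 * ‖x‖ ^ 2 + θ x) (x y : EuclideanSpace ℝ ι) :
    0 ≤ μ * ‖x - y‖ ^ 2 + (fderiv ℝ θ x - fderiv ℝ θ y) (x - y) := by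
  have hnorm : ∀ z : EuclideanSpace ℝ ι,
      HasFDerivAt (fun x : EuclideanSpace ℝ ι => μ / 2 * ‖x‖ ^ 2) (μ • innerSL ℝ z) z := fun z => by
    have h := (hasStrictFDerivAt_norm_sq z).hasFDerivAt.const_mul (μ / 2)
    refine h.congr_fderiv (ContinuousLinearMap.ext fun w => ?_)
    simp only [FunLike.coe_smul, Pi.smul_apply, innerSL_apply_apply, smul_eq_mul,
      two_smul, add_apply]
    ring
  have hderiv : ∀ z : EuclideanSpace ℝ ι, HasFDerivAt (fun x => μ / 2 * ‖x‖ ^ 2 + θ x)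
      (μ • innerSL ℝ z + fderiv ℝ θ z) z := fun z => (hnorm z).add (hdiff z).hasFDerivAt
  have happly : ∀ z w : EuclideanSpace ℝ ι,
      (μ • innerSL ℝ z + fderiv ℝ θ z) w = μ * ⟪z, w⟫ + fderiv ℝ θ z w := fun z w => by
    simp only [add_apply, FunLike.coe_smul, Pi.smul_apply, innerSL_apply_apply, smul_eq_mul]
  have h1 := ConvexOn.apply_add_fderiv_le hconv (mem_univ x) (hderiv x) (mem_univ y)
  have h2 := ConvexOn.apply_add_fderiv_le hconv (mem_univ y) (hderiv y) (mem_univ x)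
  rw [happly] at h1 h2
  have e3 : μ * ⟪x, y - x⟫ + μ * ⟪y, x - y⟫ = -(μ * ‖x - y‖ ^ 2) := by
    have h3 : ⟪x, y - x⟫ + ⟪y, x - y⟫ = -‖x - y‖ ^ 2 := by
      rw [← neg_sub x y, inner_neg_right, ← real_inner_self_eq_norm_sq, inner_sub_left]
      ring
    rw [← mul_add, h3, mul_neg]
  have e4 : fderiv ℝ θ x (y - x) = -(fderiv ℝ θ x (x - y)) := by
    rw [← neg_sub x y, ContinuousLinearMap.map_neg]
  rw [FunLike.coe_sub, Pi.sub_apply]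
  linarith [h1, h2, e3, e4]

/-- **Serre 2024, Lemma 12** (unit-lattice normalisation). Let `θ : ℝⁿ → ℝ` be differentiable
and `ℤⁿ`-periodic, and let `x ↦ μ|x|²/2 + θ(x)` be convex, `μ > 0`. Then
`|∇θ(x)| ≤ μ √n` for every `x`. (Serre: lattice `2πℤⁿ`, bound `2μ√nπ`.) Proof: with `y` a
maximum point of `θ` (`∇θ(y) = 0`), `g = ∇θ(x)`, and a lattice vector `ω` such that
`α = x + ω - y + g/(2μ) ∈ [-1/2, 1/2]ⁿ`, monotonicity of the gradient of the convex function
between `x + ω` and `y` reads `μ|α - g/(2μ)|² + ⟪g, α - g/(2μ)⟫ ≥ 0`, i.e.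
`|g|² ≤ 4μ²|α|² ≤ μ² n`. [cite: Serre2024, Appendix A, Lemma 12 (p. 1441)] -/
theorem norm_gradient_le_of_periodic_of_convexOn {θ : EuclideanSpace ℝ ι → ℝ} {μ : ℝ}
    (hμ : 0 < μ) (hper : ∀ (x : EuclideanSpace ℝ ι) (k : ι → ℤ), θ (x + Torus.latticeVec k) = θ x)
    (hdiff : Differentiable ℝ θ) (hconv : ConvexOn ℝ Set.univ fun x => μ / 2 * ‖x‖ ^ 2 + θ x)
    (x : EuclideanSpace ℝ ι) :
    ‖gradient θ x‖ ≤ μ * Real.sqrt (Fintype.card ι) := by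
  -- a maximum point `y` of `θ`, where the derivative vanishes
  obtain ⟨y, hy⟩ := exists_forall_le_of_periodic hdiff.continuous hper
  have hDy : fderiv ℝ θ y = 0 :=
    IsLocalMax.fderiv_eq_zero (Filter.Eventually.of_forall fun z => hy z)
  -- the gradient `g` at `x` and the rounded point
  set g : EuclideanSpace ℝ ι := gradient θ x with hg
  have hgapply : ∀ w, fderiv ℝ θ x w = ⟪g, w⟫ := fun w => by
    rw [hg, gradient, toDual_symm_apply]
  set c : ℝ := (2 * μ)⁻¹ with hc
  set z : EuclideanSpace ℝ ι := x - y + c • g with hz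
  set k : ι → ℤ := fun i => -⌊z i + 2⁻¹⌋ with hk
  set α : EuclideanSpace ℝ ι := z + Torus.latticeVec k with hα
  have hαi : ∀ i, |α i| ≤ 2⁻¹ := by
    intro i
    have h1 : α i = z i - ⌊z i + 2⁻¹⌋ := by
      rw [hα, PiLp.add_apply, Torus.latticeVec_apply, hk, Int.cast_neg, sub_eq_add_neg]
    rw [h1, abs_le]
    constructor
    · linarith [Int.floor_le (z i + 2⁻¹)]
    · linarith [Int.lt_floor_add_one (z i + 2⁻¹)]
  have hαnorm : ‖α‖ ^ 2 ≤ Fintype.card ι * 4⁻¹ := by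
    rw [EuclideanSpace.real_norm_sq_eq]
    calc ∑ i, α i ^ 2 ≤ ∑ _i : ι, (4⁻¹ : ℝ) := Finset.sum_le_sum fun i _ => by
            have := hαi i
            rw [abs_le] at this
            nlinarith [this.1, this.2]
      _ = Fintype.card ι * 4⁻¹ := by rw [Finset.sum_const, Finset.card_univ, nsmul_eq_mul]
  -- monotonicity between `x + ω` and `y`, `ω = latticeVec k`
  have hmono := inner_fderiv_sub_nonneg_of_convexOn_add_sq hdiff hconv (x + Torus.latticeVec k) y
  rw [fderiv_add_latticeVec_of_periodic hper x k, hDy, sub_zero, hgapply] at hmono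
  have hw : x + Torus.latticeVec k - y = α - c • g := by
    rw [hα, hz]
    abel
  rw [hw] at hmono
  -- expand: `μ|α - c g|² + ⟪g, α - c g⟫ = μ|α|² - |g|²/(4μ)`
  have hexp : μ * ‖α - c • g‖ ^ 2 + ⟪g, α - c • g⟫ = μ * ‖α‖ ^ 2 - ‖g‖ ^ 2 / (4 * μ) := by
    rw [norm_sub_sq_real, inner_sub_right, real_inner_smul_right, real_inner_smul_right, norm_smul,
      Real.norm_eq_abs, real_inner_self_eq_norm_sq, real_inner_comm α g, hc, abs_inv, abs_of_pos
      (by positivity : (0 : ℝ) < 2 * μ)]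
    field_simp
    ring
  rw [hexp] at hmono
  -- conclude `|g|² ≤ 4 μ² |α|² ≤ μ² n`
  have hg2 : ‖g‖ ^ 2 ≤ (μ * Real.sqrt (Fintype.card ι)) ^ 2 := by
    rw [mul_pow, Real.sq_sqrt (Nat.cast_nonneg _)]
    have h4 : ‖g‖ ^ 2 ≤ 4 * μ ^ 2 * ‖α‖ ^ 2 := by
      have := mul_le_mul_of_nonneg_left (sub_nonneg.1 hmono) (by positivity : (0 : ℝ) ≤ 4 * μ)
      have e : 4 * μ * (‖g‖ ^ 2 / (4 * μ)) = ‖g‖ ^ 2 := by field_simp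
      nlinarith [this, e]
    nlinarith [h4, hαnorm, sq_nonneg μ]
  exact (abs_le_of_sq_le_sq' hg2 (by positivity)).2

end Literature.Analysis.Convex
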